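import Literature.NumberTheory.CubicFields.DavenportHeilbronnMaximality
import HarnessLib

/-!
# Davenport–Heilbronn's original description of `U_p`: no primitive zero `(x, y)` with `p² ∣ f`, `p ∣ f_u, f_v`

Topic `Literature/NumberTheory/CubicFields`; a reformulation of `DavenportHeilbronnMaximality.MemU`
(BTT 2023, Prop. 2.2: `f ∈ U_p` iff `f` is not a multiple of `p` and no `GL₂(ℤ)`-translate of `f`
has `p² ∣ a`, `p ∣ b`).

Bhargava–Taniguchi–Thorne 2023, Prop. 2.2 cite [DH] = Davenport–Heilbronn 1971 for the maximality
condition; Davenport–Heilbronn define `U_p` through values of `f` and its partial derivatives.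
The two descriptions are equivalent by an elementary computation: if `γ = (x y; r s) ∈ GL₂(ℤ)`
then `a(γ · f) = ± f(x, y)` and `b(γ · f) = ± (r f_u(x, y) + s f_v(x, y))`, and Euler's identity
`x f_u + y f_v = 3 f` turns "`p ∣ b` for some completion `(r, s)`" into "`p ∣ f_u(x,y)` and
`p ∣ f_v(x,y)`". This file proves, for every natural number `p` (no primality needed):

* `BinaryCubic.derivU`, `derivV`, `euler_identity` — `u f_u + v f_v = 3 f`;
* `subst_a_eq_eval`, `subst_b_eq_deriv` — the first two coefficients of `f ∘ γ`;
* **`BinaryCubic.not_memU_iff_exists_singular_zero`** — `f ∉ U_p` iff `p ∣ f`, or there are coprime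
  `x, y` with `p² ∣ f(x, y)`, `p ∣ f_u(x, y)`, `p ∣ f_v(x, y)` (a zero of `f` mod `p²` that is a
  singular point of `f` mod `p`);
* `BinaryCubic.memU_iff_forall_coprime` — the positive form.

## References

* M. Bhargava, T. Taniguchi, F. Thorne, *Improved error estimates for the Davenport–Heilbronn
  theorems*, Math. Ann. 389 (2024) = arXiv:2107.12819, Prop. 2.2 [BhargavaTaniguchiThorne2023].
* H. Davenport, H. Heilbronn, *On the density of discriminants of cubic fields II*, Proc. Roy.
  Soc. London A 322 (1971), §2 (the sets `U_p`, `V_p`) [DavenportHeilbronn1971].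
-/

namespace Literature.NumberTheory.CubicFields

namespace BinaryCubic

variable {R : Type*} [CommRing R]

/-- The partial derivative `f_u = 3a u² + 2b uv + c v²`. [folklore] -/
def derivU (f : BinaryCubic R) (u v : R) : R :=
  3 * f.a * u ^ 2 + 2 * f.b * u * v + f.c * v ^ 2

/-- The partial derivative `f_v = b u² + 2c uv + 3d v²`. [folklore] -/
def derivV (f : BinaryCubic R) (u v : R) : R :=
  f.b * u ^ 2 + 2 * f.c * u * v + 3 * f.d * v ^ 2

/-- **Euler's identity** for the cubic form: `u f_u + v f_v = 3 f`. [folklore] -/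
theorem euler_identity (f : BinaryCubic R) (u v : R) : u * f.derivU u v + v * f.derivV u v = 3 * f.eval u v := by
  simp only [derivU, derivV, eval]; ring

/-- The `u³`-coefficient of `f ∘ γ` is the value of `f` at the first row of `γ`. [folklore] -/
theorem subst_a_eq_eval (f : BinaryCubic R) (γ : Matrix (Fin 2) (Fin 2) R) :
    (f.subst γ).a = f.eval (γ 0 0) (γ 0 1) := by
  simp only [subst, eval]

/-- The `u²v`-coefficient of `f ∘ γ` is `r f_u(x, y) + s f_v(x, y)` for `γ = (x y; r s)`. [folklore] -/
theorem subst_b_eq_deriv (f : BinaryCubic R) (γ : Matrix (Fin 2) (Fin 2) R) :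
    (f.subst γ).b = γ 1 0 * f.derivU (γ 0 0) (γ 0 1) + γ 1 1 * f.derivV (γ 0 0) (γ 0 1) := by
  simp only [subst, derivU, derivV]; ring

/-- From `p ∣ r f_u + s f_v`, `p ∣ x f_u + y f_v` and `xs − yr = ±1`: `p ∣ f_u` and `p ∣ f_v`. [folklore] -/
theorem dvd_of_dvd_combinations {p x y r s A B : ℤ} (hdet : IsUnit (x * s - y * r))
    (h1 : p ∣ r * A + s * B) (h2 : p ∣ x * A + y * B) : p ∣ A ∧ p ∣ B := by
  have hA : p ∣ (x * s - y * r) * A := by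
    have : (x * s - y * r) * A = s * (x * A + y * B) - y * (r * A + s * B) := by ring
    rw [this]; exact dvd_sub (dvd_mul_of_dvd_right h2 s) (dvd_mul_of_dvd_right h1 y)
  have hB : p ∣ (x * s - y * r) * B := by
    have : (x * s - y * r) * B = x * (r * A + s * B) - r * (x * A + y * B) := by ring
    rw [this]; exact dvd_sub (dvd_mul_of_dvd_right h1 x) (dvd_mul_of_dvd_right h2 r)
  rcases Int.isUnit_iff.mp hdet with h | h <;> rw [h] at hA hB
  · exact ⟨by simpa using hA, by simpa using hB⟩
  · exact ⟨by simpa using hA, by simpa using hB⟩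

/-- **Davenport–Heilbronn's description of `U_p`.** For any `p`, `f ∉ U_p` iff `f` is a multiple
of `p`, or `f` has a *singular zero*: coprime `x, y` with `p² ∣ f(x, y)`, `p ∣ f_u(x, y)`,
`p ∣ f_v(x, y)` (equivalently, a `GL₂(ℤ)`-translate with `p² ∣ a`, `p ∣ b`, BTT Prop. 2.2). [cite: DavenportHeilbronn1971, §2 (definition of U_p via f ≡ 0 (mod p²), f_u ≡ f_v ≡ 0 (mod p) at a primitive point)] -/
theorem not_memU_iff_exists_singular_zero {p : ℕ} {f : BinaryCubic ℤ} :
    ¬ f.MemU p ↔ f.IsMultiple p ∨ ∃ x y : ℤ, IsCoprime x y ∧ (p : ℤ) ^ 2 ∣ f.eval x y ∧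
      (p : ℤ) ∣ f.derivU x y ∧ (p : ℤ) ∣ f.derivV x y := by
  rw [MemU]
  push Not
  constructor
  · intro h
    by_cases hm : f.IsMultiple p
    · exact Or.inl hm
    · right
      obtain ⟨g, ⟨γ, hγu, rfl⟩, hpa, hpb⟩ := h hm
      -- the first row `(x, y)` of `γ` and a Bézout completion from `det γ = ±1`
      refine ⟨γ 0 0, γ 0 1, ?_, ?_, ?_⟩
      · rw [Matrix.det_fin_two] at hγu
        rcases Int.isUnit_iff.mp hγu with h1 | h1
        · exact ⟨γ 1 1, -γ 1 0, by linear_combination h1⟩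
        · exact ⟨-γ 1 1, γ 1 0, by linear_combination -h1⟩
      · -- `a(γ · f) = det γ · f(x, y)`
        rw [twist, smul_a, subst_a_eq_eval] at hpa
        exact (IsUnit.dvd_mul_left hγu).mp hpa
      · rw [twist, smul_b, subst_b_eq_deriv] at hpb
        rw [twist, smul_a, subst_a_eq_eval] at hpa
        have hb' : (p : ℤ) ∣ γ 1 0 * f.derivU (γ 0 0) (γ 0 1) + γ 1 1 * f.derivV (γ 0 0) (γ 0 1) :=
          (IsUnit.dvd_mul_left hγu).mp hpb
        have ha' : (p : ℤ) ∣ f.eval (γ 0 0) (γ 0 1) :=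
          (dvd_pow_self (p : ℤ) two_ne_zero).trans ((IsUnit.dvd_mul_left hγu).mp hpa)
        have heuler : (p : ℤ) ∣ γ 0 0 * f.derivU (γ 0 0) (γ 0 1) + γ 0 1 * f.derivV (γ 0 0) (γ 0 1) := by
          rw [euler_identity]; exact dvd_mul_of_dvd_right ha' 3
        rw [Matrix.det_fin_two] at hγu
        exact dvd_of_dvd_combinations hγu hb' heuler
  · rintro (hm | ⟨x, y, hxy, h2, hu, hv⟩) hnm
    · exact absurd hm hnm
    · -- complete `(x, y)` to `γ = (x y; r s)` of determinant `1`
      obtain ⟨a, b, hab⟩ := hxy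
      let γ : Matrix (Fin 2) (Fin 2) ℤ := !![x, y; -b, a]
      have hdet : γ.det = 1 := by
        rw [Matrix.det_fin_two_of]; linear_combination hab
      refine ⟨twist γ f, ⟨γ, by rw [hdet]; exact isUnit_one, rfl⟩, ?_, ?_⟩
      · rw [twist, hdet, one_smul, subst_a_eq_eval]
        simpa [γ] using h2
      · rw [twist, hdet, one_smul, subst_b_eq_deriv]
        simp only [γ, Matrix.of_apply, Matrix.cons_val', Matrix.cons_val_zero, Matrix.cons_val_one,
          Matrix.cons_val_fin_one, Matrix.empty_val']
        exact dvd_add (dvd_mul_of_dvd_right hu _) (dvd_mul_of_dvd_right hv _)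

/-- The positive form: **`f ∈ U_p` iff `p ∤ f` and `f` has no singular zero** (`(x, y)` coprime
with `p² ∣ f`, `p ∣ f_u`, `p ∣ f_v`). [folklore] -/
theorem memU_iff_forall_coprime {p : ℕ} {f : BinaryCubic ℤ} :
    f.MemU p ↔ ¬ f.IsMultiple p ∧ ∀ x y : ℤ, IsCoprime x y → (p : ℤ) ^ 2 ∣ f.eval x y →
      (p : ℤ) ∣ f.derivU x y → ¬ (p : ℤ) ∣ f.derivV x y := by
  have h := not_memU_iff_exists_singular_zero (p := p) (f := f)
  constructor
  · intro hU
    refine ⟨fun hm => ?_, fun x y hxy h2 hu hv => ?_⟩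
    · exact (h.mpr (Or.inl hm)) hU
    · exact (h.mpr (Or.inr ⟨x, y, hxy, h2, hu, hv⟩)) hU
  · rintro ⟨hm, hall⟩
    by_contra hU
    rcases h.mp hU with hm' | ⟨x, y, hxy, h2, hu, hv⟩
    · exact hm hm'
    · exact hall x y hxy h2 hu hv

/-- Example: for `p = 3`, `f = u³ + 3uv² + 9v³ ∉ U_3` — it has the singular zero `(0, 1)`:
`f(0,1) = 9`, `f_u(0,1) = 3`, `f_v(0,1) = 27`. [folklore] -/
example : ¬ (⟨1, 0, 3, 9⟩ : BinaryCubic ℤ).MemU 3 :=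
  not_memU_iff_exists_singular_zero.mpr (Or.inr ⟨0, 1, isCoprime_zero_left.mpr isUnit_one,
    by norm_num [eval], by norm_num [derivU], by norm_num [derivV]⟩)

end BinaryCubic

end Literature.NumberTheory.CubicFields
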